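import Mathlib
import HarnessLib
import Summits.Ventures.LatticeQCDFlow.Exactness.EnergyViolationSecondOrder
import Summits.Ventures.LatticeQCDFlow.Exactness.CreutzEstimatorVariance
import Summits.Ventures.LatticeQCDFlow.Exactness.SUNMultiStepLeapfrogHMC
import Summits.Ventures.LatticeQCDFlow.Exactness.Omf2ProposalLaws

/-!
# The `dH`-column laws on the `SU(N)` rung: `⟨ΔH⟩ = ½⟨ΔH²⟩ + third order` and `Var e^{−ΔH} = ⟨e^{ΔH}⟩ − 1` for the `n`-step leapfrog AND OMF2 proposals in general coordinates

HONEST FRAMING: exact (Metropolis-corrected) sampling algorithms for lattice gauge theory;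
figures of merit are autocorrelation/cost numbers at stated couplings and volumes; no
continuum-physics claim.

Venture `LatticeQCDFlow` (cell pub-lqcd), topic `Exactness`; FANOUT rows 9/14 (the `SU(N)` engine kernel
`sunLeapfrogProposalN ι hι ε g n` of `SUNMultiStepLeapfrogHMC.lean`, any coordinates `ι : E →ₗ su(N)`, any
additive Haar momentum measure `μ^{⊗L}`).  Corollary file, def-free: the abstract laws
`abs_integral_deltaH_sub_half_sq_le` (`EnergyViolationSecondOrder.lean`) and `integral_sq_exp_neg_deltaH_sub_one`
(`CreutzEstimatorVariance.lean`) applied to the measurable, `Haar^{⊗L} ⊗ μ^{⊗L}`-preserving involution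
`sunLeapfrogProposalN` (facts of `SUNMultiStepLeapfrogHMC.lean`), for EVERY Hamiltonian `H` on phase space with
`e^{−H}` integrable and every measurable force `g`:
* `sunLeapfrogProposalN_deltaH_second_order` — `|∫ ΔH e^{−H} − ½ ∫ ΔH² e^{−H}| ≤ (1/6) ∫ |ΔH|³ e^{|ΔH|} e^{−H}`
  (given the three moments);
* `sunLeapfrogProposalN_creutz_variance` — `∫ (e^{−ΔH} − 1)² e^{−H} = ∫ e^{ΔH} e^{−H} − ∫ e^{−H}` (given
  `e^{ΔH}e^{−H}` integrable).
* §2 (GEN-19) `sunOmf2ProposalN_deltaH_second_order`, `sunOmf2ProposalN_creutz_variance` — the same two laws for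
  the `SU(N)` OMF2 proposal `flip ∘ (omf2Word g₁ (mulDrift (sunExpDrift ι hι δ)) g₂)ⁿ` of `Omf2ProposalLaws` §0, every
  pair of measurable forces.
NOT CLAIMED: finiteness of the moments for the engine's Gaussian momenta; floating point.
-/

noncomputable section

namespace Summit.Ventures.LatticeQCDFlow.Exactness

open Set Function MeasureTheory Filter
open Literature.MathematicalPhysics.QuantumFieldTheory
open scoped Matrix

set_option backward.isDefEq.respectTransparency false

section SUN

variable {N : Type*} [Fintype N] [DecidableEq N] {E : Type*} [NormedAddCommGroup E] [NormedSpace ℝ E]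
  [MeasurableSpace E] [BorelSpace E] [FiniteDimensional ℝ E]
  (ι : E →ₗ[ℝ] Matrix N N ℂ) (hι : ∀ a, (ι a)ᴴ = -ι a ∧ (ι a).trace = 0) {L : Type*} [Fintype L]
  (μ : Measure E) [μ.IsAddHaarMeasure] (ε : ℝ) {g : (L → Matrix.specialUnitaryGroup N ℂ) → L → E} (n : ℕ)

/-- **`⟨ΔH⟩ = ½⟨ΔH²⟩ + third order` on the `SU(N)` rung**: the `n`-step leapfrog proposal in general coordinates,
every `H` with `e^{−H}` integrable over `Haar^{⊗L} ⊗ μ^{⊗L}`, every measurable force (given the three moments). -/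
theorem sunLeapfrogProposalN_deltaH_second_order (hg : Measurable g)
    {H : (L → Matrix.specialUnitaryGroup N ℂ) × (L → E) → ℝ}
    (h0 : Integrable (fun z => Real.exp (-H z))
      ((Measure.pi fun _ : L => haarProbability (Matrix.specialUnitaryGroup N ℂ)).prod (Measure.pi fun _ : L => μ)))
    (h1 : Integrable (fun z => deltaH H (⇑(sunLeapfrogProposalN ι hι ε g n)) z * Real.exp (-H z))
      ((Measure.pi fun _ : L => haarProbability (Matrix.specialUnitaryGroup N ℂ)).prod (Measure.pi fun _ : L => μ)))
    (h2 : Integrable (fun z => deltaH H (⇑(sunLeapfrogProposalN ι hι ε g n)) z ^ 2 * Real.exp (-H z))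
      ((Measure.pi fun _ : L => haarProbability (Matrix.specialUnitaryGroup N ℂ)).prod (Measure.pi fun _ : L => μ)))
    (h3 : Integrable (fun z => |deltaH H (⇑(sunLeapfrogProposalN ι hι ε g n)) z| ^ 3 *
        Real.exp |deltaH H (⇑(sunLeapfrogProposalN ι hι ε g n)) z| * Real.exp (-H z))
      ((Measure.pi fun _ : L => haarProbability (Matrix.specialUnitaryGroup N ℂ)).prod (Measure.pi fun _ : L => μ))) :
    |∫ z, deltaH H (⇑(sunLeapfrogProposalN ι hι ε g n)) z * Real.exp (-H z)
        ∂((Measure.pi fun _ : L => haarProbability (Matrix.specialUnitaryGroup N ℂ)).prod (Measure.pi fun _ : L => μ))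
      - 1 / 2 * ∫ z, deltaH H (⇑(sunLeapfrogProposalN ι hι ε g n)) z ^ 2 * Real.exp (-H z)
        ∂((Measure.pi fun _ : L => haarProbability (Matrix.specialUnitaryGroup N ℂ)).prod (Measure.pi fun _ : L => μ))|
      ≤ 1 / 6 * ∫ z, |deltaH H (⇑(sunLeapfrogProposalN ι hι ε g n)) z| ^ 3 *
          Real.exp |deltaH H (⇑(sunLeapfrogProposalN ι hι ε g n)) z| * Real.exp (-H z)
        ∂((Measure.pi fun _ : L => haarProbability (Matrix.specialUnitaryGroup N ℂ)).prod (Measure.pi fun _ : L => μ)) :=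
  abs_integral_deltaH_sub_half_sq_le
    (μ := (Measure.pi fun _ : L => haarProbability (Matrix.specialUnitaryGroup N ℂ)).prod (Measure.pi fun _ : L => μ))
    (H := H) (Ψ := ⇑(sunLeapfrogProposalN ι hι ε g n))
    (measurable_sunLeapfrogProposalN ι hι ε n hg) (involutive_sunLeapfrogProposalN (L := L) ι hι ε g n)
    (measurePreserving_sunLeapfrogProposalN ι hι ε n μ hg) h0 h1 h2 h3

/-- **`Var e^{−ΔH} = ⟨e^{ΔH}⟩ − 1` on the `SU(N)` rung** (un-normalised): every `H` with `e^{−H}` and `e^{ΔH}e^{−H}`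
integrable, every measurable force. -/
theorem sunLeapfrogProposalN_creutz_variance (hg : Measurable g)
    {H : (L → Matrix.specialUnitaryGroup N ℂ) × (L → E) → ℝ}
    (h0 : Integrable (fun z => Real.exp (-H z))
      ((Measure.pi fun _ : L => haarProbability (Matrix.specialUnitaryGroup N ℂ)).prod (Measure.pi fun _ : L => μ)))
    (hP : Integrable (fun z => Real.exp (deltaH H (⇑(sunLeapfrogProposalN ι hι ε g n)) z) * Real.exp (-H z))
      ((Measure.pi fun _ : L => haarProbability (Matrix.specialUnitaryGroup N ℂ)).prod (Measure.pi fun _ : L => μ))) :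
    ∫ z, (Real.exp (-deltaH H (⇑(sunLeapfrogProposalN ι hι ε g n)) z) - 1) ^ 2 * Real.exp (-H z)
        ∂((Measure.pi fun _ : L => haarProbability (Matrix.specialUnitaryGroup N ℂ)).prod (Measure.pi fun _ : L => μ))
      = ∫ z, Real.exp (deltaH H (⇑(sunLeapfrogProposalN ι hι ε g n)) z) * Real.exp (-H z)
          ∂((Measure.pi fun _ : L => haarProbability (Matrix.specialUnitaryGroup N ℂ)).prod (Measure.pi fun _ : L => μ))
        - ∫ z, Real.exp (-H z)
          ∂((Measure.pi fun _ : L => haarProbability (Matrix.specialUnitaryGroup N ℂ)).prod (Measure.pi fun _ : L => μ)) :=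
  integral_sq_exp_neg_deltaH_sub_one
    (μ := (Measure.pi fun _ : L => haarProbability (Matrix.specialUnitaryGroup N ℂ)).prod (Measure.pi fun _ : L => μ))
    (H := H) (Ψ := ⇑(sunLeapfrogProposalN ι hι ε g n))
    (measurable_sunLeapfrogProposalN ι hι ε n hg) (involutive_sunLeapfrogProposalN (L := L) ι hι ε g n)
    (measurePreserving_sunLeapfrogProposalN ι hι ε n μ hg) h0 hP

end SUN

/-! ## §2 The `SU(N)` OMF2 proposal (general coordinates) -/

section SUNOmf2

variable {N : Type*} [Fintype N] [DecidableEq N] {E : Type*} [NormedAddCommGroup E] [NormedSpace ℝ E]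
  [MeasurableSpace E] [BorelSpace E] [FiniteDimensional ℝ E]
  (ι : E →ₗ[ℝ] Matrix N N ℂ) (hι : ∀ a, (ι a)ᴴ = -ι a ∧ (ι a).trace = 0) {L : Type*} [Fintype L]
  (μ : Measure E) [μ.IsAddHaarMeasure] (δ : ℝ) {g₁ g₂ : (L → Matrix.specialUnitaryGroup N ℂ) → L → E} (n : ℕ)

/-- **`⟨ΔH⟩ = ½⟨ΔH²⟩ + third order` for the `SU(N)` OMF2 proposal** `flip ∘ (omf2Word g₁ (mulDrift e_δ) g₂)ⁿ` in
general coordinates, every `H` with `e^{−H}` integrable over `Haar^{⊗L} ⊗ μ^{⊗L}`, every pair of measurable forces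
(given the three moments). -/
theorem sunOmf2ProposalN_deltaH_second_order (hg₁ : Measurable g₁) (hg₂ : Measurable g₂)
    {H : (L → Matrix.specialUnitaryGroup N ℂ) × (L → E) → ℝ}
    (h0 : Integrable (fun z => Real.exp (-H z))
      ((Measure.pi fun _ : L => haarProbability (Matrix.specialUnitaryGroup N ℂ)).prod (Measure.pi fun _ : L => μ)))
    (h1 : Integrable (fun z => deltaH H (⇑((flip : Equiv.Perm ((L → Matrix.specialUnitaryGroup N ℂ) × (L → E))) *
        omf2Word g₁ (mulDrift (sunExpDrift ι hι δ)) g₂ ^ n)) z * Real.exp (-H z))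
      ((Measure.pi fun _ : L => haarProbability (Matrix.specialUnitaryGroup N ℂ)).prod (Measure.pi fun _ : L => μ)))
    (h2 : Integrable (fun z => deltaH H (⇑((flip : Equiv.Perm ((L → Matrix.specialUnitaryGroup N ℂ) × (L → E))) *
        omf2Word g₁ (mulDrift (sunExpDrift ι hι δ)) g₂ ^ n)) z ^ 2 * Real.exp (-H z))
      ((Measure.pi fun _ : L => haarProbability (Matrix.specialUnitaryGroup N ℂ)).prod (Measure.pi fun _ : L => μ)))
    (h3 : Integrable (fun z => |deltaH H (⇑((flip : Equiv.Perm ((L → Matrix.specialUnitaryGroup N ℂ) × (L → E))) *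
        omf2Word g₁ (mulDrift (sunExpDrift ι hι δ)) g₂ ^ n)) z| ^ 3 *
        Real.exp |deltaH H (⇑((flip : Equiv.Perm ((L → Matrix.specialUnitaryGroup N ℂ) × (L → E))) *
          omf2Word g₁ (mulDrift (sunExpDrift ι hι δ)) g₂ ^ n)) z| * Real.exp (-H z))
      ((Measure.pi fun _ : L => haarProbability (Matrix.specialUnitaryGroup N ℂ)).prod (Measure.pi fun _ : L => μ))) :
    |∫ z, deltaH H (⇑((flip : Equiv.Perm ((L → Matrix.specialUnitaryGroup N ℂ) × (L → E))) *
          omf2Word g₁ (mulDrift (sunExpDrift ι hι δ)) g₂ ^ n)) z * Real.exp (-H z)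
        ∂((Measure.pi fun _ : L => haarProbability (Matrix.specialUnitaryGroup N ℂ)).prod (Measure.pi fun _ : L => μ))
      - 1 / 2 * ∫ z, deltaH H (⇑((flip : Equiv.Perm ((L → Matrix.specialUnitaryGroup N ℂ) × (L → E))) *
          omf2Word g₁ (mulDrift (sunExpDrift ι hι δ)) g₂ ^ n)) z ^ 2 * Real.exp (-H z)
        ∂((Measure.pi fun _ : L => haarProbability (Matrix.specialUnitaryGroup N ℂ)).prod (Measure.pi fun _ : L => μ))|
      ≤ 1 / 6 * ∫ z, |deltaH H (⇑((flip : Equiv.Perm ((L → Matrix.specialUnitaryGroup N ℂ) × (L → E))) *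
            omf2Word g₁ (mulDrift (sunExpDrift ι hι δ)) g₂ ^ n)) z| ^ 3 *
          Real.exp |deltaH H (⇑((flip : Equiv.Perm ((L → Matrix.specialUnitaryGroup N ℂ) × (L → E))) *
            omf2Word g₁ (mulDrift (sunExpDrift ι hι δ)) g₂ ^ n)) z| * Real.exp (-H z)
        ∂((Measure.pi fun _ : L => haarProbability (Matrix.specialUnitaryGroup N ℂ)).prod (Measure.pi fun _ : L => μ)) :=
  abs_integral_deltaH_sub_half_sq_le
    (μ := (Measure.pi fun _ : L => haarProbability (Matrix.specialUnitaryGroup N ℂ)).prod (Measure.pi fun _ : L => μ))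
    (H := H) (Ψ := ⇑((flip : Equiv.Perm ((L → Matrix.specialUnitaryGroup N ℂ) × (L → E))) *
      omf2Word g₁ (mulDrift (sunExpDrift ι hι δ)) g₂ ^ n))
    (measurable_sunOmf2ProposalN ι hι δ n hg₁ hg₂) (involutive_sunOmf2ProposalN ι hι g₁ g₂ δ n)
    (measurePreserving_sunOmf2ProposalN ι hι δ n μ hg₁ hg₂) h0 h1 h2 h3

/-- **`Var e^{−ΔH} = ⟨e^{ΔH}⟩ − 1` for the `SU(N)` OMF2 proposal** (un-normalised): every `H` with `e^{−H}` and
`e^{ΔH}e^{−H}` integrable, every pair of measurable forces. -/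
theorem sunOmf2ProposalN_creutz_variance (hg₁ : Measurable g₁) (hg₂ : Measurable g₂)
    {H : (L → Matrix.specialUnitaryGroup N ℂ) × (L → E) → ℝ}
    (h0 : Integrable (fun z => Real.exp (-H z))
      ((Measure.pi fun _ : L => haarProbability (Matrix.specialUnitaryGroup N ℂ)).prod (Measure.pi fun _ : L => μ)))
    (hP : Integrable (fun z => Real.exp (deltaH H (⇑((flip : Equiv.Perm ((L → Matrix.specialUnitaryGroup N ℂ) × (L → E))) *
        omf2Word g₁ (mulDrift (sunExpDrift ι hι δ)) g₂ ^ n)) z) * Real.exp (-H z))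
      ((Measure.pi fun _ : L => haarProbability (Matrix.specialUnitaryGroup N ℂ)).prod (Measure.pi fun _ : L => μ))) :
    ∫ z, (Real.exp (-deltaH H (⇑((flip : Equiv.Perm ((L → Matrix.specialUnitaryGroup N ℂ) × (L → E))) *
          omf2Word g₁ (mulDrift (sunExpDrift ι hι δ)) g₂ ^ n)) z) - 1) ^ 2 * Real.exp (-H z)
        ∂((Measure.pi fun _ : L => haarProbability (Matrix.specialUnitaryGroup N ℂ)).prod (Measure.pi fun _ : L => μ))
      = ∫ z, Real.exp (deltaH H (⇑((flip : Equiv.Perm ((L → Matrix.specialUnitaryGroup N ℂ) × (L → E))) *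
            omf2Word g₁ (mulDrift (sunExpDrift ι hι δ)) g₂ ^ n)) z) * Real.exp (-H z)
          ∂((Measure.pi fun _ : L => haarProbability (Matrix.specialUnitaryGroup N ℂ)).prod (Measure.pi fun _ : L => μ))
        - ∫ z, Real.exp (-H z)
          ∂((Measure.pi fun _ : L => haarProbability (Matrix.specialUnitaryGroup N ℂ)).prod (Measure.pi fun _ : L => μ)) :=
  integral_sq_exp_neg_deltaH_sub_one
    (μ := (Measure.pi fun _ : L => haarProbability (Matrix.specialUnitaryGroup N ℂ)).prod (Measure.pi fun _ : L => μ))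
    (H := H) (Ψ := ⇑((flip : Equiv.Perm ((L → Matrix.specialUnitaryGroup N ℂ) × (L → E))) *
      omf2Word g₁ (mulDrift (sunExpDrift ι hι δ)) g₂ ^ n))
    (measurable_sunOmf2ProposalN ι hι δ n hg₁ hg₂) (involutive_sunOmf2ProposalN ι hι g₁ g₂ δ n)
    (measurePreserving_sunOmf2ProposalN ι hι δ n μ hg₁ hg₂) h0 hP

end SUNOmf2

end Summit.Ventures.LatticeQCDFlow.Exactness
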